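import Literature.Barriers.Schanuel.NesterenkoModularScope
import Literature.Barriers.Schanuel.AlgebraicIndependenceOfLogarithms
import Literature.Barriers.Schanuel.LargeTranscendenceDegree
import Literature.Barriers.Schanuel.AxSchanuelFunctionalNotNumericalNarrow
import Literature.NumberTheory.Transcendental.RankOneGridTrdeg
import Literature.NumberTheory.Transcendental.PhilipponCriterionProofs
import Summits.Schanuel.Schanuel.Theorems.SoloInformedPiELadder

/-!
# Door (M), part 2: bookkeeping of the two conjectural rungs at `τ = i/π`

Soloist file (`solo-Schanuel-informed`, 2026-08-19, s8), part 2 of 3; companion of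
`SoloInformedModularDoor` (identities, unconditional floor) and `SoloInformedModularDoorConjecture`
(the conjectures as named hypotheses). Pure field bookkeeping, no transcendence input: the
hypotheses below are the CONTENT AT THE SINGLE POINT `τ₀ = i/π` (nome `q = e^{−2}`) of two
conjectures in print, and the conclusions are statements about `e` and `π`. Throughout
`P, Q, R` denote `ramanujanP/Q/R (cexp (-2))`, the Ramanujan functions at `e^{−2}`.

* `FourAt := 4 ≤ trdeg ℚ(i/π, e^{−2}, P, Q, R)` — Nesterenko's Conjecture 1.11
  [cite: NesterenkoPhilippon2001, Ch. 3 Conjecture 1.11] at `τ₀` (part 3 derives it from the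
  tree's `NesterenkoConjecture_1_11_corrected`). Consequences: `4 ≤ trdeg ℚ(π, e, P, Q, R)`
  (`four_le_trdeg_pi_e_PQR_of_fourAt`); the dichotomy "`e, π` algebraically dependent ⟹
  `P, Q, R` algebraically independent" (`algebraicIndependent_PQR_of_fourAt`); and the rung
  `4 ≤ trdeg F₆` of the `F₆`-ladder, `F₆ = ℚ(e, π, e^{π²}, P, Q, R)` — but NOT `e ⟂ π`.
* `FiveAt := 5 ≤ trdeg ℚ(2πi, i/π, e^{−2}, P, Q, R)` — the quasi-modular conjecture
  [cite: Fonseca2020, Conjecture 4.8] (after [cite: Bertolin2002]; cf. [cite: Waldschmidt2004,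
  §3]) at `τ₀`. Consequences: `π, e^{−2}, P, Q, R` algebraically independent
  (`algebraicIndependent_five_of_fiveAt`), hence **`e ⟂ π`** (`expOnePi_of_fiveAt`), R1 =
  `TwoOfEPiExpPiSq` (`twoOfEPiExpPiSq_of_fiveAt`) and `5 ≤ trdeg F₆`; and `5 ≤ trdeg F₆ ⟹ R1`
  on its own (`twoOfEPiExpPiSq_of_five_le_trdeg_six`).
* From the dual point `iπ` (part 3): `π, e^{−2π²}, P, Q, R` algebraically independent ⟹
  `π ⟂ e^{π²}` (`algebraicIndependent_pi_expPiSq_of_dual`).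
-/

noncomputable section

open Complex IntermediateField
open scoped Real
open Literature.NumberTheory.Transcendental (ExpOnePiAlgebraicIndependent trdeg_adjoin_union_le)
open Literature.Barriers.Schanuel (ramanujanP ramanujanQ ramanujanR trdeg_mono
  trdeg_adjoin_union_eq_of_isAlgebraic algebraicIndependent_of_le_trdeg_adjoin
  natCast_le_trdeg_of_algebraicIndependent isAlgebraic_I)

namespace Summit.Schanuel.Schanuel.Theorems

/-! ### Cardinal bookkeeping -/

/-- From `4 ≤ a + b`, `b ≤ 1`, `a ≤ 3` conclude `3 ≤ a`. -/
theorem three_le_of_four_le_add_door {a b : Cardinal} (h : 4 ≤ a + b) (hb : b ≤ 1)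
    (ha : a ≤ ((3 : ℕ) : Cardinal)) : 3 ≤ a := by
  obtain ⟨m, rfl⟩ := Cardinal.lt_aleph0.mp (ha.trans_lt (Cardinal.natCast_lt_aleph0 (n := 3)))
  obtain ⟨k, rfl⟩ := Cardinal.lt_aleph0.mp (hb.trans_lt (Cardinal.natCast_lt_aleph0 (n := 1)))
  norm_cast at h hb ha ⊢
  omega

/-- From `5 ≤ a + b`, `b ≤ 3`, `a ≤ 3` conclude `2 ≤ a`. -/
theorem two_le_of_five_le_add_door {a b : Cardinal} (h : 5 ≤ a + b)
    (hb : b ≤ ((3 : ℕ) : Cardinal)) (ha : a ≤ ((3 : ℕ) : Cardinal)) : 2 ≤ a := by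
  obtain ⟨m, rfl⟩ := Cardinal.lt_aleph0.mp (ha.trans_lt (Cardinal.natCast_lt_aleph0 (n := 3)))
  obtain ⟨k, rfl⟩ := Cardinal.lt_aleph0.mp (hb.trans_lt (Cardinal.natCast_lt_aleph0 (n := 3)))
  norm_cast at h hb ha ⊢
  omega

/-! ### §A Consequences of `FourAt` (Conjecture 1.11 at `i/π`) -/

/-- **`FourAt ⟹ 4 ≤ trdeg ℚ(π, e, P, Q, R)`**: of the five numbers at least four are
algebraically independent (`i/π, e^{−2}` are traded for `π, e` up to the algebraic number `i`). -/
theorem four_le_trdeg_pi_e_PQR_of_fourAt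
    (h4 : (4 : Cardinal) ≤ Algebra.trdeg ℚ ↥(adjoin ℚ ({I / (π : ℂ), cexp (-2),
      ramanujanP (cexp (-2)), ramanujanQ (cexp (-2)), ramanujanR (cexp (-2))} : Set ℂ))) :
    (4 : Cardinal) ≤ Algebra.trdeg ℚ ↥(adjoin ℚ ({(π : ℂ), cexp 1,
      ramanujanP (cexp (-2)), ramanujanQ (cexp (-2)), ramanujanR (cexp (-2))} : Set ℂ)) := by
  set S : Set ℂ := {(π : ℂ), cexp 1, ramanujanP (cexp (-2)), ramanujanQ (cexp (-2)),
    ramanujanR (cexp (-2))} with hS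
  set F : IntermediateField ℚ ℂ := adjoin ℚ (S ∪ {I}) with hF
  have hpi : (π : ℂ) ∈ F := subset_adjoin ℚ _ (Or.inl (by simp [hS]))
  have he : cexp 1 ∈ F := subset_adjoin ℚ _ (Or.inl (by simp [hS]))
  have hP : ramanujanP (cexp (-2)) ∈ F := subset_adjoin ℚ _ (Or.inl (by simp [hS]))
  have hQ : ramanujanQ (cexp (-2)) ∈ F := subset_adjoin ℚ _ (Or.inl (by simp [hS]))
  have hR : ramanujanR (cexp (-2)) ∈ F := subset_adjoin ℚ _ (Or.inl (by simp [hS]))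
  have hI : I ∈ F := subset_adjoin ℚ _ (Or.inr rfl)
  have hq : cexp (-2) ∈ F := by
    rw [show cexp (-2) = (cexp 1)⁻¹ * (cexp 1)⁻¹ by
      rw [← Complex.exp_neg, ← Complex.exp_add]; norm_num]
    exact mul_mem (inv_mem he) (inv_mem he)
  have hle : adjoin ℚ ({I / (π : ℂ), cexp (-2), ramanujanP (cexp (-2)), ramanujanQ (cexp (-2)),
      ramanujanR (cexp (-2))} : Set ℂ) ≤ F := by
    rw [adjoin_le_iff]
    intro w hw
    simp only [Set.mem_insert_iff, Set.mem_singleton_iff] at hw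
    rcases hw with rfl | rfl | rfl | rfl | rfl
    exacts [div_mem hI hpi, hq, hP, hQ, hR]
  have hIalg : ∀ t ∈ ({I} : Set ℂ), IsAlgebraic ℚ t := by
    intro t ht; rw [Set.mem_singleton_iff.mp ht]; exact isAlgebraic_I
  exact (h4.trans (trdeg_mono hle)).trans_eq (trdeg_adjoin_union_eq_of_isAlgebraic S {I} hIalg)

/-- **`FourAt ⟹` dichotomy: if `e` and `π` are algebraically DEpendent then
`P(e^{−2}), Q(e^{−2}), R(e^{−2})` are algebraically independent** (Nesterenko's theorem gives only
"three of `e^{−2}, P, Q, R`"). `FourAt` does not give `e ⟂ π` itself. -/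
theorem algebraicIndependent_PQR_of_fourAt
    (h4 : (4 : Cardinal) ≤ Algebra.trdeg ℚ ↥(adjoin ℚ ({I / (π : ℂ), cexp (-2),
      ramanujanP (cexp (-2)), ramanujanQ (cexp (-2)), ramanujanR (cexp (-2))} : Set ℂ)))
    (hdep : ¬ ExpOnePiAlgebraicIndependent) :
    AlgebraicIndependent ℚ ![ramanujanP (cexp (-2)), ramanujanQ (cexp (-2)),
      ramanujanR (cexp (-2))] := by
  have h4' := four_le_trdeg_pi_e_PQR_of_fourAt h4
  set v : Fin 3 → ℂ := ![ramanujanP (cexp (-2)), ramanujanQ (cexp (-2)), ramanujanR (cexp (-2))]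
    with hv
  have hsplit : ({(π : ℂ), cexp 1, ramanujanP (cexp (-2)), ramanujanQ (cexp (-2)),
      ramanujanR (cexp (-2))} : Set ℂ) = Set.range v ∪ {(π : ℂ), cexp 1} := by
    ext w
    simp only [hv, Set.mem_insert_iff, Set.mem_singleton_iff, Set.mem_union, Set.mem_range]
    constructor
    · rintro (rfl | rfl | rfl | rfl | rfl)
      · exact Or.inr (Or.inl rfl)
      · exact Or.inr (Or.inr rfl)
      · exact Or.inl ⟨0, rfl⟩
      · exact Or.inl ⟨1, rfl⟩
      · exact Or.inl ⟨2, rfl⟩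
    · rintro (⟨i, rfl⟩ | rfl | rfl)
      · fin_cases i <;> simp
      · exact Or.inl rfl
      · exact Or.inr (Or.inl rfl)
  have h4'' : (4 : Cardinal) ≤ Algebra.trdeg ℚ ↥(adjoin ℚ (Set.range v ∪ {(π : ℂ), cexp 1})) :=
    h4'.trans_eq (equivOfEq (F := ℚ) (E := ℂ) (congrArg (adjoin ℚ) hsplit)).trdeg_eq
  have hsub := trdeg_adjoin_union_le (K := ℚ) (Set.range v) ({(π : ℂ), cexp 1} : Set ℂ)
  have hpe : Algebra.trdeg ℚ ↥(adjoin ℚ ({(π : ℂ), cexp 1} : Set ℂ)) ≤ 1 := by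
    have hnot : ¬ (2 : Cardinal) ≤
        Algebra.trdeg ℚ ↥(adjoin ℚ ({((Real.exp 1 : ℝ) : ℂ), (Real.pi : ℂ)} : Set ℂ)) := by
      rw [two_le_trdeg_adjoin_pair_iff (Real.exp 1) Real.pi]; exact hdep
    have heq : ({(π : ℂ), cexp 1} : Set ℂ) = {((Real.exp 1 : ℝ) : ℂ), (Real.pi : ℂ)} := by
      rw [Complex.ofReal_exp, Complex.ofReal_one, Set.pair_comm]
    rw [heq]
    by_contra hgt
    have h1 : (1 : Cardinal) < _ := not_le.mp hgt
    exact hnot (calc (2 : Cardinal) = 1 + 1 := by norm_num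
      _ ≤ _ := Cardinal.add_one_le_of_lt h1)
  have hPQR : Algebra.trdeg ℚ ↥(adjoin ℚ (Set.range v)) ≤ ((3 : ℕ) : Cardinal) :=
    Literature.NumberTheory.Transcendental.Philippon1986_criterion.trdeg_adjoin_range_le (F := ℚ) v
  have h3 : (3 : Cardinal) ≤ Algebra.trdeg ℚ ↥(adjoin ℚ (Set.range v)) :=
    three_le_of_four_le_add_door (h4''.trans hsub) hpe hPQR
  exact algebraicIndependent_of_le_trdeg_adjoin _ (by exact_mod_cast h3)

/-- **`FourAt ⟹ 4 ≤ trdeg F₆`**, `F₆ = ℚ(e, π, e^{π²}, P, Q, R)` — the first open rung of the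
`F₆`-ladder (incomparable with R1 by bookkeeping). -/
theorem four_le_trdeg_six_of_fourAt
    (h4 : (4 : Cardinal) ≤ Algebra.trdeg ℚ ↥(adjoin ℚ ({I / (π : ℂ), cexp (-2),
      ramanujanP (cexp (-2)), ramanujanQ (cexp (-2)), ramanujanR (cexp (-2))} : Set ℂ))) :
    (4 : Cardinal) ≤ Algebra.trdeg ℚ ↥(adjoin ℚ ({cexp 1, (π : ℂ), cexp ((π : ℂ) ^ 2),
      ramanujanP (cexp (-2)), ramanujanQ (cexp (-2)), ramanujanR (cexp (-2))} : Set ℂ)) := by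
  refine (four_le_trdeg_pi_e_PQR_of_fourAt h4).trans (trdeg_mono (adjoin.mono ℚ _ _ ?_))
  intro w hw
  simp only [Set.mem_insert_iff, Set.mem_singleton_iff] at hw ⊢
  tauto

/-! ### §B Consequences of `FiveAt` (the quasi-modular conjecture at `i/π`) -/

/-- **`FiveAt ⟹ π, e^{−2}, P(e^{−2}), Q(e^{−2}), R(e^{−2})` algebraically independent.**
The single relation `2πi · (i/π) = −2` absorbs the deficit `6 − 5`. -/
theorem algebraicIndependent_five_of_fiveAt
    (h5 : (5 : Cardinal) ≤ Algebra.trdeg ℚ ↥(adjoin ℚ ({2 * (π : ℂ) * I, I / π, cexp (-2),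
      ramanujanP (cexp (-2)), ramanujanQ (cexp (-2)), ramanujanR (cexp (-2))} : Set ℂ))) :
    AlgebraicIndependent ℚ ![(π : ℂ), cexp (-2), ramanujanP (cexp (-2)), ramanujanQ (cexp (-2)),
      ramanujanR (cexp (-2))] := by
  set v : Fin 5 → ℂ := ![(π : ℂ), cexp (-2), ramanujanP (cexp (-2)), ramanujanQ (cexp (-2)),
      ramanujanR (cexp (-2))] with hv
  set F : IntermediateField ℚ ℂ := adjoin ℚ (Set.range v ∪ {I}) with hF
  have hpi : (π : ℂ) ∈ F := subset_adjoin ℚ _ (Or.inl ⟨0, rfl⟩)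
  have hq : cexp (-2) ∈ F := subset_adjoin ℚ _ (Or.inl ⟨1, rfl⟩)
  have hP : ramanujanP (cexp (-2)) ∈ F := subset_adjoin ℚ _ (Or.inl ⟨2, rfl⟩)
  have hQ : ramanujanQ (cexp (-2)) ∈ F := subset_adjoin ℚ _ (Or.inl ⟨3, rfl⟩)
  have hR : ramanujanR (cexp (-2)) ∈ F := subset_adjoin ℚ _ (Or.inl ⟨4, rfl⟩)
  have hI : I ∈ F := subset_adjoin ℚ _ (Or.inr rfl)
  have h2 : (2 : ℂ) ∈ F := by exact_mod_cast IntermediateField.natCast_mem F 2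
  have hle : adjoin ℚ ({2 * (π : ℂ) * I, I / π, cexp (-2), ramanujanP (cexp (-2)),
      ramanujanQ (cexp (-2)), ramanujanR (cexp (-2))} : Set ℂ) ≤ F := by
    rw [adjoin_le_iff]
    intro w hw
    simp only [Set.mem_insert_iff, Set.mem_singleton_iff] at hw
    rcases hw with rfl | rfl | rfl | rfl | rfl | rfl
    exacts [mul_mem (mul_mem h2 hpi) hI, div_mem hI hpi, hq, hP, hQ, hR]
  have hIalg : ∀ t ∈ ({I} : Set ℂ), IsAlgebraic ℚ t := by
    intro t ht; rw [Set.mem_singleton_iff.mp ht]; exact isAlgebraic_I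
  have h5' : (5 : Cardinal) ≤ Algebra.trdeg ℚ ↥(adjoin ℚ (Set.range v)) :=
    (h5.trans (trdeg_mono hle)).trans_eq (trdeg_adjoin_union_eq_of_isAlgebraic _ {I} hIalg)
  exact algebraicIndependent_of_le_trdeg_adjoin _ (by exact_mod_cast h5')

/-- `π, e^{−2}` algebraically independent (over `ℚ`, in `ℂ`) `⟹ e ⟂ π`. -/
theorem expOnePi_of_algebraicIndependent_pi_expNegTwo
    (h2 : AlgebraicIndependent ℚ ![(π : ℂ), cexp (-2)]) : ExpOnePiAlgebraicIndependent := by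
  set F : IntermediateField ℚ ℂ := adjoin ℚ ({((Real.exp 1 : ℝ) : ℂ), (Real.pi : ℂ)} : Set ℂ)
    with hF
  have he : cexp 1 ∈ F := by
    rw [show cexp 1 = ((Real.exp 1 : ℝ) : ℂ) by rw [Complex.ofReal_exp, Complex.ofReal_one]]
    exact subset_adjoin ℚ _ (by simp)
  have hpi : (π : ℂ) ∈ F := subset_adjoin ℚ _ (by simp)
  have hq : cexp (-2) ∈ F := by
    rw [show cexp (-2) = (cexp 1)⁻¹ * (cexp 1)⁻¹ by
      rw [← Complex.exp_neg, ← Complex.exp_add]; norm_num]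
    exact mul_mem (inv_mem he) (inv_mem he)
  have h2F : (2 : Cardinal) ≤ Algebra.trdeg ℚ ↥F := by
    exact_mod_cast natCast_le_trdeg_of_algebraicIndependent h2
      (fun i => by fin_cases i; exacts [hpi, hq])
  exact (two_le_trdeg_adjoin_pair_iff (Real.exp 1) Real.pi).mp h2F

/-- **`FiveAt ⟹ e ⟂ π`**: the quasi-modular conjecture at the one point `i/π` implies the
algebraic independence of `e` and `π`. -/
theorem expOnePi_of_fiveAt
    (h5 : (5 : Cardinal) ≤ Algebra.trdeg ℚ ↥(adjoin ℚ ({2 * (π : ℂ) * I, I / π, cexp (-2),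
      ramanujanP (cexp (-2)), ramanujanQ (cexp (-2)), ramanujanR (cexp (-2))} : Set ℂ))) :
    ExpOnePiAlgebraicIndependent := by
  refine expOnePi_of_algebraicIndependent_pi_expNegTwo ?_
  have := (algebraicIndependent_five_of_fiveAt h5).comp ![(0 : Fin 5), 1] (by decide)
  convert this using 1
  funext i; fin_cases i <;> rfl

/-- **`FiveAt ⟹ R1`** (the first open rung `TwoOfEPiExpPiSq` of `SoloInformedPiELadder`). -/
theorem twoOfEPiExpPiSq_of_fiveAt
    (h5 : (5 : Cardinal) ≤ Algebra.trdeg ℚ ↥(adjoin ℚ ({2 * (π : ℂ) * I, I / π, cexp (-2),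
      ramanujanP (cexp (-2)), ramanujanQ (cexp (-2)), ramanujanR (cexp (-2))} : Set ℂ))) :
    TwoOfEPiExpPiSq :=
  twoOfEPiExpPiSq_of_expOnePiAlgebraicIndependent (expOnePi_of_fiveAt h5)

/-- **`FiveAt ⟹ 5 ≤ trdeg F₆`.** -/
theorem five_le_trdeg_six_of_fiveAt
    (h5 : (5 : Cardinal) ≤ Algebra.trdeg ℚ ↥(adjoin ℚ ({2 * (π : ℂ) * I, I / π, cexp (-2),
      ramanujanP (cexp (-2)), ramanujanQ (cexp (-2)), ramanujanR (cexp (-2))} : Set ℂ))) :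
    (5 : Cardinal) ≤ Algebra.trdeg ℚ ↥(adjoin ℚ ({cexp 1, (π : ℂ), cexp ((π : ℂ) ^ 2),
      ramanujanP (cexp (-2)), ramanujanQ (cexp (-2)), ramanujanR (cexp (-2))} : Set ℂ)) := by
  set F := adjoin ℚ ({cexp 1, (π : ℂ), cexp ((π : ℂ) ^ 2),
      ramanujanP (cexp (-2)), ramanujanQ (cexp (-2)), ramanujanR (cexp (-2))} : Set ℂ) with hF
  have he : cexp 1 ∈ F := subset_adjoin ℚ _ (by simp)
  have hpi : (π : ℂ) ∈ F := subset_adjoin ℚ _ (by simp)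
  have hP : ramanujanP (cexp (-2)) ∈ F := subset_adjoin ℚ _ (by simp)
  have hQ : ramanujanQ (cexp (-2)) ∈ F := subset_adjoin ℚ _ (by simp)
  have hR : ramanujanR (cexp (-2)) ∈ F := subset_adjoin ℚ _ (by simp)
  have hq : cexp (-2) ∈ F := by
    rw [show cexp (-2) = (cexp 1)⁻¹ * (cexp 1)⁻¹ by
      rw [← Complex.exp_neg, ← Complex.exp_add]; norm_num]
    exact mul_mem (inv_mem he) (inv_mem he)
  exact_mod_cast natCast_le_trdeg_of_algebraicIndependent (algebraicIndependent_five_of_fiveAt h5)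
    (fun i => by fin_cases i; exacts [hpi, hq, hP, hQ, hR])

/-- **`5 ≤ trdeg F₆ ⟹ R1`**: the rung `5 ≤ trdeg ℚ(e, π, e^{π²}, P, Q, R)` already contains the
first open rung at `(1, πi)` (subadditivity: `trdeg F₆ ≤ trdeg ℚ(e, π, e^{π²}) + 3`). -/
theorem twoOfEPiExpPiSq_of_five_le_trdeg_six
    (h5 : (5 : Cardinal) ≤ Algebra.trdeg ℚ ↥(adjoin ℚ ({cexp 1, (π : ℂ), cexp ((π : ℂ) ^ 2),
      ramanujanP (cexp (-2)), ramanujanQ (cexp (-2)), ramanujanR (cexp (-2))} : Set ℂ))) :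
    TwoOfEPiExpPiSq := by
  set v : Fin 3 → ℂ := ![ramanujanP (cexp (-2)), ramanujanQ (cexp (-2)), ramanujanR (cexp (-2))]
    with hv
  have hsplit : ({cexp 1, (π : ℂ), cexp ((π : ℂ) ^ 2), ramanujanP (cexp (-2)),
      ramanujanQ (cexp (-2)), ramanujanR (cexp (-2))} : Set ℂ) =
      ({cexp 1, (π : ℂ), cexp ((π : ℂ) ^ 2)} : Set ℂ) ∪ Set.range v := by
    ext w
    simp only [hv, Set.mem_insert_iff, Set.mem_singleton_iff, Set.mem_union, Set.mem_range]
    constructor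
    · rintro (rfl | rfl | rfl | rfl | rfl | rfl)
      · exact Or.inl (Or.inl rfl)
      · exact Or.inl (Or.inr (Or.inl rfl))
      · exact Or.inl (Or.inr (Or.inr rfl))
      · exact Or.inr ⟨0, rfl⟩
      · exact Or.inr ⟨1, rfl⟩
      · exact Or.inr ⟨2, rfl⟩
    · rintro ((rfl | rfl | rfl) | ⟨i, rfl⟩)
      · exact Or.inl rfl
      · exact Or.inr (Or.inl rfl)
      · exact Or.inr (Or.inr (Or.inl rfl))
      · fin_cases i <;> simp
  have h5' : (5 : Cardinal) ≤ Algebra.trdeg ℚ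
      ↥(adjoin ℚ (({cexp 1, (π : ℂ), cexp ((π : ℂ) ^ 2)} : Set ℂ) ∪ Set.range v)) :=
    h5.trans_eq (equivOfEq (F := ℚ) (E := ℂ) (congrArg (adjoin ℚ) hsplit)).trdeg_eq
  have hsub := trdeg_adjoin_union_le (K := ℚ) ({cexp 1, (π : ℂ), cexp ((π : ℂ) ^ 2)} : Set ℂ)
    (Set.range v)
  have hPQR : Algebra.trdeg ℚ ↥(adjoin ℚ (Set.range v)) ≤ ((3 : ℕ) : Cardinal) :=
    Literature.NumberTheory.Transcendental.Philippon1986_criterion.trdeg_adjoin_range_le (F := ℚ) v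
  have h3 : Algebra.trdeg ℚ ↥(adjoin ℚ ({cexp 1, (π : ℂ), cexp ((π : ℂ) ^ 2)} : Set ℂ)) ≤
      ((3 : ℕ) : Cardinal) := by
    have hr : ({cexp 1, (π : ℂ), cexp ((π : ℂ) ^ 2)} : Set ℂ) =
        Set.range ![cexp 1, (π : ℂ), cexp ((π : ℂ) ^ 2)] := by
      ext w
      simp only [Set.mem_insert_iff, Set.mem_singleton_iff, Set.mem_range]
      constructor
      · rintro (rfl | rfl | rfl); exacts [⟨0, rfl⟩, ⟨1, rfl⟩, ⟨2, rfl⟩]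
      · rintro ⟨i, rfl⟩; fin_cases i <;> simp
    rw [hr]
    exact Literature.NumberTheory.Transcendental.Philippon1986_criterion.trdeg_adjoin_range_le
      (F := ℚ) ![cexp 1, (π : ℂ), cexp ((π : ℂ) ^ 2)]
  exact two_le_of_five_le_add_door (h5'.trans hsub) hPQR h3

/-! ### §C From the dual point `iπ`: `π ⟂ e^{π²}` -/

/-- **`π, e^{−2π²}, P, Q, R` algebraically independent `⟹ π ⟂ e^{π²}`** (the second rank-two
instance of Schanuel's conjecture adjacent to R1; printed open [cite: BakerTNT1975, Ch. 12 §1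
p. 119]). Part 3 derives the hypothesis from the quasi-modular conjecture at `iπ`. -/
theorem algebraicIndependent_pi_expPiSq_of_dual
    (h5 : AlgebraicIndependent ℚ ![(π : ℂ), cexp (-(2 * (π : ℂ) ^ 2)), ramanujanP (cexp (-2)),
      ramanujanQ (cexp (-2)), ramanujanR (cexp (-2))]) :
    AlgebraicIndependent ℚ ![Real.pi, Real.exp (Real.pi ^ 2)] := by
  have h2 : AlgebraicIndependent ℚ ![(π : ℂ), cexp (-(2 * (π : ℂ) ^ 2))] := by
    have := h5.comp ![(0 : Fin 5), 1] (by decide)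
    convert this using 1
    funext i; fin_cases i <;> rfl
  set F : IntermediateField ℚ ℂ :=
    adjoin ℚ ({(Real.pi : ℂ), ((Real.exp (Real.pi ^ 2) : ℝ) : ℂ)} : Set ℂ) with hF
  have hpi : (π : ℂ) ∈ F := subset_adjoin ℚ _ (by simp)
  have he : cexp ((π : ℂ) ^ 2) ∈ F := by
    rw [show cexp ((π : ℂ) ^ 2) = ((Real.exp (Real.pi ^ 2) : ℝ) : ℂ) by
      rw [Complex.ofReal_exp, Complex.ofReal_pow]]
    exact subset_adjoin ℚ _ (by simp)
  have hq : cexp (-(2 * (π : ℂ) ^ 2)) ∈ F := by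
    rw [show cexp (-(2 * (π : ℂ) ^ 2)) = (cexp ((π : ℂ) ^ 2))⁻¹ * (cexp ((π : ℂ) ^ 2))⁻¹ by
      rw [← Complex.exp_neg, ← Complex.exp_add]; ring_nf]
    exact mul_mem (inv_mem he) (inv_mem he)
  have h2F : (2 : Cardinal) ≤ Algebra.trdeg ℚ ↥F := by
    exact_mod_cast natCast_le_trdeg_of_algebraicIndependent h2
      (fun i => by fin_cases i; exacts [hpi, hq])
  exact (two_le_trdeg_adjoin_pair_iff Real.pi (Real.exp (Real.pi ^ 2))).mp h2F

end Summit.Schanuel.Schanuel.Theorems
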